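import Summits.QuantumAdvantage.QuantumAdvantage.Theorems.CharDialLevelDialA

/-!
# CharDialLevelDialB — TREE PART B of the decomp-qadv lens-5 g29 node «LevelDial» on `CharDial.FrobStructureLawOdd` (stmt-QuantumAdvantage-27205):
# the KERNEL BRIDGE `rPrime_succ` / `tail_of_base : RPrimeAt p K (nB p K) → ∀ m ≥ nB p K, RPrimeAt p K m` (uniform in `p, K`), the assembly
# `closes : BaseOdd → GlueOdd → IslandDial.IslandOdd → CharDial.FrobStructureLawOdd` BY NAME, and the EXACT split
# `target_iff_pieces : FrobStructureLawOdd ↔ BaseOdd ∧ GlueOdd ∧ IslandOdd` (+ `exchCoreAt_iff : ExchCoreAt p ↔ BaseAt p ∧ GlueAt p`,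
# `baseAt_iff_tailAt`).  Verbatim from the node file (namespace `Theses.LevelDial → Theorems.LevelDial`), part A imported.
-/

set_option autoImplicit false
set_option linter.dupNamespace false

namespace Summit.QuantumAdvantage.QuantumAdvantage.Theorems.LevelDial

open Finset
open Summit.QuantumAdvantage.AdviceFreeQNC0
open Literature.Computability.MetaComplexity Literature.Computability.MetaComplexity.Smolensky
open Summit.QuantumAdvantage.QuantumAdvantage.Theorems.IslandDial (Exch TopConst ExchCoreAt ExchCoreOdd IslandAt IslandOdd
  exch_weight_form)

/-! ### The bridge: one level up from the base and the previous level -/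

section Bridge

variable {p : ℕ} [hp : Fact p.Prime]

/-- **INDUCTION STEP.**  Base level `nB p K` and level `m ≥ nB p K` give level `m + 1`. -/
theorem rPrime_succ {K m : ℕ} (hbase : RPrimeAt p K (nB p K)) (hm : nB p K ≤ m) (ih : RPrimeAt p K m) :
    RPrimeAt p K (m + 1) := by
  classical
  intro n f X hXc hdep hf hγ
  obtain ⟨γ, hγ0, htop⟩ := hγ
  have hnB : nB p K = 2 * K + 1 + max p (K + 1) := rfl
  have hmaxp : p ≤ max p (K + 1) := le_max_left _ _
  have hmaxK : K + 1 ≤ max p (K + 1) := le_max_right _ _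
  -- a coordinate to slice along
  obtain ⟨x, hx⟩ : X.Nonempty := Finset.card_pos.1 (by omega)
  have hX₁c : (X.erase x).card = m := by
    rw [Finset.card_erase_of_mem hx, hXc]
    rfl
  -- both slices are in the class at level m
  have hsl : ∀ b : Bool, ∃ Y : Finset (Fin n), Y ⊆ X.erase x ∧ m ≤ Y.card + K ∧
      Exch (fun u => f (SubLog.merge (X.erase x) u (fun _ => b))) Y := fun b =>
    ih n _ (X.erase x) hX₁c (depOn_slice f (X.erase x) _) (hasDegF_slice hf (X.erase x) _)
      ⟨γ, hγ0, topConst_slice hf htop (subset_refl _) (Finset.erase_subset x X) _⟩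
  obtain ⟨Y0, hY0sub, hY0c, hY0ex⟩ := hsl false
  obtain ⟨Y1, hY1sub, hY1c, hY1ex⟩ := hsl true
  -- the common core R
  set R : Finset (Fin n) := Y0 ∩ Y1 with hRdef
  have hRX₁ : R ⊆ X.erase x := Finset.inter_subset_left.trans hY0sub
  have hRX : R ⊆ X := hRX₁.trans (Finset.erase_subset x X)
  have hRcard : m ≤ R.card + 2 * K := by
    have h1 : (Y0 ∪ Y1).card + R.card = Y0.card + Y1.card := Finset.card_union_add_card_inter Y0 Y1
    have h2 : (Y0 ∪ Y1).card ≤ (X.erase x).card := Finset.card_le_card (Finset.union_subset hY0sub hY1sub)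
    rw [hX₁c] at h2
    omega
  have hexR : Exch f R := exch_of_two_slices hdep hRX₁ fun b => by
    cases b
    · exact exch_mono hY0ex Finset.inter_subset_left
    · exact exch_mono hY1ex Finset.inter_subset_right
  -- the weight form on R
  obtain ⟨H, hH⟩ := exch_weight_form p f R hf (by omega) hexR
  -- J = X ∖ R, the sub-slice support X₂ = J ∪ R'
  set J : Finset (Fin n) := X \ R with hJdef
  have hJc : J.card + R.card = m + 1 := by rw [hJdef, Finset.card_sdiff_add_card_eq_card hRX, hXc]
  obtain ⟨R', hR'R, hR'c⟩ : ∃ R' ⊆ R, R'.card = nB p K - J.card := Finset.exists_subset_card_eq (by omega)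
  have hdisj : Disjoint J R' := by
    rw [hJdef]
    exact (disjoint_sdiff_self_left : Disjoint (X \ R) R).mono_right hR'R
  set X₂ : Finset (Fin n) := J ∪ R' with hX₂def
  have hX₂c : X₂.card = nB p K := by
    rw [hX₂def, Finset.card_union_of_disjoint hdisj, hR'c]
    omega
  have hX₂X : X₂ ⊆ X := Finset.union_subset Finset.sdiff_subset (hR'R.trans hRX)
  -- the zero sub-slice g
  set g : (Fin n → Bool) → Bool := fun u => f (SubLog.merge X₂ u (fun _ => false)) with hgdef
  have hS : ∀ w : Fin n → Bool, (∀ z ∈ R, z ∉ R' → w z = false) → g w = f w := by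
    intro w hw
    refine slice_eq_self hdep fun i hi hiX₂ => ?_
    have hiR : i ∈ R := by
      by_contra hiR
      exact hiX₂ (Finset.mem_union_left _ (Finset.mem_sdiff.2 ⟨hi, hiR⟩))
    have hiR' : i ∉ R' := fun h => hiX₂ (Finset.mem_union_right _ h)
    exact hw i hiR hiR'
  obtain ⟨Y', hY'sub, hY'c, hY'ex⟩ := hbase n g X₂ hX₂c (depOn_slice f X₂ _) (hasDegF_slice hf X₂ _)
    ⟨γ, hγ0, topConst_slice hf htop (subset_refl _) hX₂X _⟩
  -- a pivot r₀ ∈ R' ∩ Y'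
  have hR'p : p ≤ R'.card := by omega
  obtain ⟨r₀, hr₀⟩ : (R' ∩ Y').Nonempty := by
    rw [← Finset.card_pos]
    have h1 : (R' \ Y').card ≤ (X₂ \ Y').card :=
      Finset.card_le_card (Finset.sdiff_subset_sdiff Finset.subset_union_right (subset_refl _))
    have h2 : (X₂ \ Y').card + Y'.card = X₂.card := Finset.card_sdiff_add_card_eq_card hY'sub
    have h3 : (R' \ Y').card + (R' ∩ Y').card = R'.card := Finset.card_sdiff_add_card_inter R' Y'
    omega
  have hr₀R' : r₀ ∈ R' := (Finset.mem_inter.1 hr₀).1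
  have hr₀Y' : r₀ ∈ Y' := (Finset.mem_inter.1 hr₀).2
  have hr₀R : r₀ ∈ R := hR'R hr₀R'
  -- UP: every j ∈ J ∩ Y' is exchangeable with r₀ for f itself
  have hup : ∀ j ∈ J, j ∈ Y' → ∀ u, f (u ∘ Equiv.swap j r₀) = f u := by
    intro j hjJ hjY'
    have hjR : j ∉ R := (Finset.mem_sdiff.1 hjJ).2
    exact lift_swap hH hR'R hR'p hr₀R' hjR hS fun u => hY'ex j hjY' r₀ hr₀Y' u
  -- the exchangeable set one level up
  refine ⟨R ∪ (J ∩ Y'), Finset.union_subset hRX (Finset.inter_subset_left.trans Finset.sdiff_subset), ?_, ?_⟩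
  · have h1 : X \ (R ∪ (J ∩ Y')) ⊆ X₂ \ Y' := by
      intro i hi
      rw [Finset.mem_sdiff] at hi ⊢
      obtain ⟨hiX, hiY⟩ := hi
      have hiR : i ∉ R := fun h => hiY (Finset.mem_union_left _ h)
      have hiJ : i ∈ J := Finset.mem_sdiff.2 ⟨hiX, hiR⟩
      exact ⟨Finset.mem_union_left _ hiJ, fun h => hiY (Finset.mem_union_right _ (Finset.mem_inter.2 ⟨hiJ, h⟩))⟩
    have h2 := Finset.card_le_card h1
    have h3 : (X \ (R ∪ (J ∩ Y'))).card + (R ∪ (J ∩ Y')).card = X.card :=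
      Finset.card_sdiff_add_card_eq_card (Finset.union_subset hRX (Finset.inter_subset_left.trans Finset.sdiff_subset))
    have h4 : (X₂ \ Y').card + Y'.card = X₂.card := Finset.card_sdiff_add_card_eq_card hY'sub
    omega
  · have hswap : ∀ a ∈ R ∪ (J ∩ Y'), ∀ u, f (u ∘ Equiv.swap r₀ a) = f u := by
      intro a ha
      rcases Finset.mem_union.1 ha with haR | haJ
      · exact fun u => hexR r₀ hr₀R a haR u
      · exact SubChar.swapInv_symm f (hup a (Finset.mem_inter.1 haJ).1 (Finset.mem_inter.1 haJ).2)
    intro a ha b hb u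
    exact SubChar.swapInv_conj f (hswap a ha) (hswap b hb) u

/-- **THE BRIDGE (kernel, uniform in `p`, `K`).**  The single finite level `nB p K` gives every level `m ≥ nB p K`. -/
theorem tail_of_base {K : ℕ} (hbase : RPrimeAt p K (nB p K)) : ∀ m : ℕ, nB p K ≤ m → RPrimeAt p K m := by
  intro m hm
  induction m, hm using Nat.le_induction with
  | base => exact hbase
  | succ m hm ih => exact rPrime_succ hbase hm ih

/-- FINITE RANGE ⟹ ASYMPTOTIC REGIME. -/
theorem tailAt_of_baseAt (p : ℕ) [Fact p.Prime] : BaseAt p → TailAt p := by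
  rintro ⟨K, hK⟩
  exact ⟨K, tail_of_base hK⟩

/-- The converse is trivial. -/
theorem baseAt_of_tailAt (p : ℕ) [Fact p.Prime] : TailAt p → BaseAt p := by
  rintro ⟨K, hK⟩
  exact ⟨K, hK _ le_rfl⟩

end Bridge

/-! ### Assembly and exactness -/

/-- ASYMPTOTIC REGIME + GLUE ⟹ piece E at `p` (outside slices of `f` over `X` are functions of `X` in the class, by the slice lemmas). -/
theorem exchCoreAt_of_tail_glue (p : ℕ) [Fact p.Prime] (hT : TailAt p) (hG : GlueAt p) : ExchCoreAt p := by
  classical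
  obtain ⟨K, hK⟩ := hT
  obtain ⟨E, hE⟩ := hG K
  refine ⟨E + nB p K, fun n f X hf hγ => ?_⟩
  by_cases hX : nB p K ≤ X.card
  · obtain ⟨γ, hγ0, htop⟩ := hγ
    obtain ⟨Y, hYX, hc, hex⟩ := hE n f X hf ⟨γ, hγ0, htop⟩ fun σ =>
      hK X.card hX n _ X rfl (depOn_slice f X σ) (hasDegF_slice hf X σ)
        ⟨γ, hγ0, topConst_slice hf htop (subset_refl _) (subset_refl _) σ⟩
    exact ⟨Y, hYX, by omega, hex⟩
  · refine ⟨∅, Finset.empty_subset _, ?_, fun i hi => absurd hi (by simp)⟩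
    rw [Finset.card_empty]
    omega

/-- Piece E at `p` from the finite range and the glue (bridge + `exchCoreAt_of_tail_glue`). -/
theorem exchCoreAt_of_pieces (p : ℕ) [Fact p.Prime] (hB : BaseAt p) (hG : GlueAt p) : ExchCoreAt p :=
  exchCoreAt_of_tail_glue p (tailAt_of_baseAt p hB) hG

/-- **`closes`**: the three pieces decide the target BY NAME (via the tree's `IslandDial.closes`). -/
theorem closes (hB : BaseOdd) (hG : GlueOdd) (hI : IslandOdd) :
    Summit.QuantumAdvantage.QuantumAdvantage.Theses.CharDial.FrobStructureLawOdd :=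
  Summit.QuantumAdvantage.QuantumAdvantage.Theorems.IslandDial.closes
    (fun p _ hp5 => exchCoreAt_of_pieces p (hB p hp5) (hG p hp5)) hI

/-- Piece E gives R′ at EVERY level (with the budget `E`): necessity of the finite range. -/
theorem rPrimeAt_of_exchCoreAt (p : ℕ) [Fact p.Prime] (hE : ExchCoreAt p) : ∃ K : ℕ, ∀ m : ℕ, RPrimeAt p K m := by
  obtain ⟨E, hE⟩ := hE
  refine ⟨E, fun m n f X hXc _ hf hγ => ?_⟩
  obtain ⟨Y, hYX, hc, hex⟩ := hE n f X hf hγ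
  exact ⟨Y, hYX, hXc ▸ hc, hex⟩

/-- Necessity of piece B at `p`. -/
theorem baseAt_of_exchCoreAt (p : ℕ) [Fact p.Prime] (hE : ExchCoreAt p) : BaseAt p := by
  obtain ⟨K, hK⟩ := rPrimeAt_of_exchCoreAt p hE
  exact ⟨K, hK _⟩

/-- Necessity of piece G at `p` (piece E gives its conclusion without the slice hypothesis). -/
theorem glueAt_of_exchCoreAt (p : ℕ) [Fact p.Prime] (hE : ExchCoreAt p) : GlueAt p := by
  obtain ⟨E, hE⟩ := hE
  exact fun K => ⟨E, fun n f X hf hγ _ => hE n f X hf hγ⟩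

/-- Necessity of the asymptotic regime at `p`. -/
theorem tailAt_of_exchCoreAt (p : ℕ) [Fact p.Prime] (hE : ExchCoreAt p) : TailAt p := by
  obtain ⟨K, hK⟩ := rPrimeAt_of_exchCoreAt p hE
  exact ⟨K, fun m _ => hK m⟩

/-- Necessity of piece B. -/
theorem baseOdd_of_target (hT : Summit.QuantumAdvantage.QuantumAdvantage.Theses.CharDial.FrobStructureLawOdd) : BaseOdd :=
  fun p _ hp5 => baseAt_of_exchCoreAt p
    (Summit.QuantumAdvantage.QuantumAdvantage.Theorems.IslandDial.exchCoreOdd_of_target hT p hp5)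

/-- Necessity of piece G. -/
theorem glueOdd_of_target (hT : Summit.QuantumAdvantage.QuantumAdvantage.Theses.CharDial.FrobStructureLawOdd) : GlueOdd :=
  fun p _ hp5 => glueAt_of_exchCoreAt p
    (Summit.QuantumAdvantage.QuantumAdvantage.Theorems.IslandDial.exchCoreOdd_of_target hT p hp5)

/-- **EXACT SPLIT**: the target is equivalent to the conjunction of the three pieces. -/
theorem target_iff_pieces :
    Summit.QuantumAdvantage.QuantumAdvantage.Theses.CharDial.FrobStructureLawOdd ↔ (BaseOdd ∧ GlueOdd ∧ IslandOdd) :=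
  ⟨fun hT => ⟨baseOdd_of_target hT, glueOdd_of_target hT,
      Summit.QuantumAdvantage.QuantumAdvantage.Theorems.IslandDial.islandOdd_of_target hT⟩,
    fun h => closes h.1 h.2.1 h.2.2⟩

/-- Piece E at `p` is equivalent to (finite range ∧ glue) at `p` — the refinement of g28's piece E is itself exact. -/
theorem exchCoreAt_iff (p : ℕ) [Fact p.Prime] : ExchCoreAt p ↔ (BaseAt p ∧ GlueAt p) :=
  ⟨fun hE => ⟨baseAt_of_exchCoreAt p hE, glueAt_of_exchCoreAt p hE⟩, fun h => exchCoreAt_of_pieces p h.1 h.2⟩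

/-- The dial read both ways at `p`: finite range ⟺ asymptotic regime (bridge one way, specialisation the other). -/
theorem baseAt_iff_tailAt (p : ℕ) [Fact p.Prime] : BaseAt p ↔ TailAt p :=
  ⟨tailAt_of_baseAt p, baseAt_of_tailAt p⟩

end Summit.QuantumAdvantage.QuantumAdvantage.Theorems.LevelDial
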